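import Literature.AlgebraicGeometry.HodgeTheory.LimitMixedHodgeStructureRelativeHomGr
import Literature.AlgebraicGeometry.HodgeTheory.LimitMixedHodgeStructureRelativeUnit
import Literature.AlgebraicGeometry.Motives.MixedHodgeStructureTateHomHodgeClasses
import HarnessLib

/-!
# Global sections `Γ(M) = Hom(𝟙, M)` of a relative limit MHS and `Hom(L₁, L₂) = Γ(Hom(L₁, L₂))`

Topic `Literature/AlgebraicGeometry/HodgeTheory` (namespace `Literature.AlgebraicGeometry.HodgeTheory`). A sequel to
`LimitMixedHodgeStructureRelativeUnit.lean` (the Tate objects `tate j = ℚ(j)` of relative limit MHS, `ℚ(0)` the unit of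
`⊗`), `LimitMixedHodgeStructureRelativeTateTwist.lean` (`L(j)`), `LimitMixedHodgeStructureRelativeHom.lean` (the inner
Hom `L₁.hom L₂`, `N_Hom f = N₂f − fN₁`, `W^f Hom = Hom(W^f₁, W^f₂)`), `LimitMixedHodgeStructureRelativeHomGr.lean` (El
Zein's `homGrMap [f] ↦ Gr f`) and, on the side of mixed Hodge structures, `Motives/MixedHodgeStructureTateHomHodgeClasses`
∕ `…InternalHomFiltrations` (`Hom_MHS(ℚ(−p), H) ≃ Hdgᵖ(H)`, `Hom_MHS(H₁, H₂(r)) ≃ Hdgʳ(Hom(H₁, H₂))`). DEFINITIONS WITH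
BODIES (`sections`, the `Hom`-constructors `Hom.ofSection`, `Hom.ofHomSectionTwist` and three `Equiv`s) and theorems;
no named fact, no instance.

For a relative limit MHS `M = (V, W^f, W, F, N)` (the tree's `RelativeLimitMixedHodgeStructure`: Kashiwara's
infinitesimal mixed Hodge module with one `N`) and `p ∈ ℤ` the **space of sections of type `(p, p)`** is
`Γ_p(M) := W^f_{2p} ∩ Hdgᵖ(V, W, F) ∩ Ker N` — the rational `(p, p)`-classes of the MHS lying in `W^f_{2p}` and killed by
`N`. THIS FILE proves `Hom(ℚ(−p), M) ≃ Γ_p(M)` (`φ ↦ φ(1)`), `Hom(L₁, L₂(p)) ≃ Γ_p(Hom(L₁, L₂))` and in particular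
**`Hom(L₁, L₂) ≃ Γ_0(Hom(L₁, L₂))`** (`φ ↦ φ`): the morphisms of relative limit MHS are exactly the linear maps which are
filtered for `W^f` in degree `0`, are `(0,0)`-classes of the internal Hom MHS, and are horizontal for `N_Hom` — the IMHM
form of «`Hom(X, Y) = Γ(Hom(X, Y))`, `Γ = Hom(𝟙, −)`».

PRINTED SOURCES, VERBATIM.
* P. Deligne, J. Milne, *Tannakian categories* (LNM 900), §1 (1.6.4): «`Hom(1, Hom(X, Y)) = Hom(1 ⊗ X, Y) = Hom(X, Y)`».
* D. Arapura, *The Hodge conjecture for rationally connected fivefolds*, §1 (p. 3): «`Hodge(H) := Hom_MHS(ℚ(0), H)`»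
  (the tree's `hodgeClasses`, `tateHomEquivHodgeClasses`).
* P. Deligne, *Théorie de Hodge II*, 1.1.12 «On a donc `Hom((A, F), (B, F)) = F⁰(Hom(A, B))`» and Remarque 2.1.11.1;
  E. Cattani et al. (eds.), *Hodge Theory*, Ch. 3 §3.1.1.3 Remark (p. 132) («`Hom_HS(H, H′)` … elements of type `(0, 0)`»),
  Remark 8.2.2 (p0338: morphisms of structures with `W^f` «compatible with the filtrations», commuting with `N`).
* M. Kashiwara, *A study of variation of mixed Hodge structure*, Publ. RIMS 22 (1986), §4.3 (p. 1007) (morphisms and the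
  inner Hom of (pre-)IMHM's), §5.8 (p. 1021) (the Tate objects).

THIS FILE (all proved).
* §1 `sections M p` (`Γ_p(M)`), `mem_sections_iff`, the three inclusions, functoriality `Hom.map_sections_le`.
* §2 (`V : Type`) **`tateHomEquivSections M p : Hom (tate (−p)) M ≃ Γ_p(M)`**, `φ ↦ φ(1)`, inverse `Hom.ofSection`
  (`q ↦ q • v`).
* §3 **`homEquivSections L₁ L₂ : Hom L₁ L₂ ≃ Γ_0(Hom(L₁, L₂))`** (the tree's `homEquiv` of
  `LimitMixedHodgeStructureRelativeHom.lean` §4 with target the submodule `sections 0`) and **`homTateTwistEquivSections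
  L₁ L₂ p : Hom L₁ (L₂.tateTwist p) ≃ Γ_p(Hom(L₁, L₂))`**, `φ ↦ φ.toLinearMap` (inverse `Hom.ofHomSectionTwist`).
* §4 the link with El Zein's map: **`homGrMap [φ] = Gr_i φ`** for a morphism `φ : L₁ → L₂` (`homGrMap_mk_toLinearMap`).

## References

* [DeligneMilne1982Tannakian] P. Deligne, J. S. Milne, *Tannakian categories*, LNM 900 (1982): §1 (1.6.4).
* [Arapura2022] D. Arapura, *The Hodge conjecture for rationally connected fivefolds* (2022): §1 (p. 3).
* [DeligneHodgeII1971] P. Deligne, *Théorie de Hodge II*, Publ. Math. IHÉS 40 (1971): 1.1.12, 2.1.11.1, 2.1.13.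
* [CattaniElZeinGriffithsLe2014] E. Cattani et al. (eds.), *Hodge Theory*, Math. Notes 49 (2014): Ch. 3 §3.1.1.3 Remark
  (p. 132), Remark 8.2.2 (p0338).
* [Kashiwara1986] M. Kashiwara, *A study of variation of mixed Hodge structure*, Publ. RIMS 22 (1986): §4.3 (p. 1007),
  §5.8 (p. 1021).
-/

noncomputable section

open scoped TensorProduct

universe u

namespace Literature.AlgebraicGeometry.HodgeTheory

open Motives Motives.MixedHodgeStructure

namespace RelativeLimitMixedHodgeStructure

/-! ## §1 The sections `Γ_p(M) = W^f_{2p} ∩ Hdgᵖ ∩ Ker N` -/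

section Sections

variable {V : Type u} [AddCommGroup V] [Module ℚ V]
variable (M : RelativeLimitMixedHodgeStructure V)

/-- **The sections of type `(p, p)` of a relative limit MHS, `Γ_p(M) := W^f_{2p} ∩ Hdgᵖ(M) ∩ Ker N`**: the rational
`(p, p)`-classes `v` (`v ∈ W_{2p}`, `1 ⊗ v ∈ Fᵖ`: the tree's `MixedHodgeStructure.hodgeClasses`) lying in `W^f_{2p}` and
killed by `N` — the values `φ(1)` of the morphisms `φ : ℚ(−p) → M` (`tateHomEquivSections`).
[cite: Arapura2022, §1 (p. 3)] [cite: DeligneMilne1982Tannakian, §1 (1.6.4)] [cite: CattaniElZeinGriffithsLe2014, Remark 8.2.2] -/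
def sections (p : ℤ) : Submodule ℚ V :=
  M.wf (2 * p) ⊓ M.toMixedHodgeStructure.hodgeClasses p ⊓ LinearMap.ker M.N

/-- Membership in `Γ_p(M)`. [cite: Arapura2022, §1 (p. 3)] [cite: CattaniElZeinGriffithsLe2014, Remark 8.2.2] -/
theorem mem_sections_iff (p : ℤ) (v : V) :
    v ∈ M.sections p ↔ v ∈ M.wf (2 * p) ∧ v ∈ M.toMixedHodgeStructure.hodgeClasses p ∧ M.N v = 0 := by
  rw [sections, Submodule.mem_inf, Submodule.mem_inf, LinearMap.mem_ker, and_assoc]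

/-- `Γ_p(M) ⊆ W^f_{2p}`. [cite: CattaniElZeinGriffithsLe2014, Remark 8.2.2] -/
theorem sections_le_wf (p : ℤ) : M.sections p ≤ M.wf (2 * p) := fun _ hv =>
  ((M.mem_sections_iff p _).1 hv).1

/-- `Γ_p(M) ⊆ Hdgᵖ(M)`. [cite: Arapura2022, §1 (p. 3)] -/
theorem sections_le_hodgeClasses (p : ℤ) : M.sections p ≤ M.toMixedHodgeStructure.hodgeClasses p := fun _ hv =>
  ((M.mem_sections_iff p _).1 hv).2.1

/-- `Γ_p(M) ⊆ Ker N`. [cite: CattaniElZeinGriffithsLe2014, Remark 8.2.2] -/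
theorem sections_le_ker (p : ℤ) : M.sections p ≤ LinearMap.ker M.N := fun _ hv =>
  LinearMap.mem_ker.2 ((M.mem_sections_iff p _).1 hv).2.2

end Sections

/-- **Functoriality of `Γ_p`**: a morphism of relative limit MHS maps `Γ_p(M₁)` into `Γ_p(M₂)` (it is filtered for
`W^f`, preserves Hodge classes, and commutes with `N`). [cite: Arapura2022, §1 Lemma 1.1] [cite: CattaniElZeinGriffithsLe2014, Remark 8.2.2] -/
theorem Hom.map_sections_le {V : Type u} [AddCommGroup V] [Module ℚ V] {V' : Type u} [AddCommGroup V'] [Module ℚ V']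
    {M₁ : RelativeLimitMixedHodgeStructure V} {M₂ : RelativeLimitMixedHodgeStructure V'} (φ : Hom M₁ M₂) (p : ℤ) :
    (M₁.sections p).map φ.toLinearMap ≤ M₂.sections p := by
  rintro _ ⟨v, hv, rfl⟩
  obtain ⟨hwf, hh, hN⟩ := (M₁.mem_sections_iff p v).1 hv
  refine (M₂.mem_sections_iff p _).2 ⟨φ.apply_mem_wf hwf, φ.toHom.apply_mem_hodgeClasses hh, ?_⟩
  rw [← φ.map_N_apply, hN, map_zero]

/-! ## §2 `Hom(ℚ(−p), M) ≃ Γ_p(M)` -/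

section TateHom

variable {V : Type} [AddCommGroup V] [Module ℚ V] (M : RelativeLimitMixedHodgeStructure V)

/-- The value at `1` of a morphism `ℚ(−p) → M` is a section of type `(p, p)`: `1 ∈ W^f_{2p} ℚ(−p)`, `φ(1)` is a
`(p, p)`-class (`MixedHodgeStructure.Hom.apply_one_mem_hodgeClasses`), and `N φ(1) = φ(N 1) = 0`.
[cite: Arapura2022, §1 (p. 3)] [cite: CattaniElZeinGriffithsLe2014, Remark 8.2.2] -/
theorem Hom.apply_one_mem_sections (p : ℤ) (φ : Hom (tate (-p)) M) : φ.toLinearMap 1 ∈ M.sections p := by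
  refine (M.mem_sections_iff p _).2 ⟨φ.apply_mem_wf ?_, MixedHodgeStructure.Hom.apply_one_mem_hodgeClasses p φ.toHom, ?_⟩
  · rw [tate_wf_of_le (show -2 * -p ≤ 2 * p by omega)]
    exact Submodule.mem_top
  · rw [← φ.map_N_apply, tate_N, LinearMap.zero_apply, map_zero]

/-- **A section `v ∈ Γ_p(M)` defines the morphism `ℚ(−p) → M`, `q ↦ q • v`** (a morphism of MHS by
`MixedHodgeStructure.Hom.ofHodgeClass`; `W^f_k ℚ(−p) = 0` for `k < 2p` and `ℚ v ⊆ W^f_{2p} ⊆ W^f_k` for `k ≥ 2p`;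
`N(q • v) = 0 = (q ↦ q • v)(N_{ℚ(−p)} q)`). [cite: Arapura2022, §1 (p. 3)] [cite: CattaniElZeinGriffithsLe2014, Remark 8.2.2] -/
def Hom.ofSection (p : ℤ) (v : M.sections p) : Hom (tate (-p)) M where
  toHom := MixedHodgeStructure.Hom.ofHodgeClass M.toMixedHodgeStructure p ⟨v, M.sections_le_hodgeClasses p v.2⟩
  map_wf_le k := by
    by_cases hk : k < -2 * -p
    · rw [tate_wf_of_lt hk, Submodule.map_bot]
      exact bot_le
    · rintro _ ⟨q, -, rfl⟩
      exact M.monotone_wf (show 2 * p ≤ k by omega) (Submodule.smul_mem _ q (M.sections_le_wf p v.2))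
  comm_N := LinearMap.ext fun q => by
    show (MixedHodgeStructure.Hom.ofHodgeClass M.toMixedHodgeStructure p
        ⟨v, M.sections_le_hodgeClasses p v.2⟩).toLinearMap ((tate (-p)).N q) =
      M.N ((MixedHodgeStructure.Hom.ofHodgeClass M.toMixedHodgeStructure p
        ⟨v, M.sections_le_hodgeClasses p v.2⟩).toLinearMap q)
    rw [tate_N, LinearMap.zero_apply, map_zero, MixedHodgeStructure.Hom.ofHodgeClass_toLinearMap_apply, map_smul,
      LinearMap.mem_ker.1 (M.sections_le_ker p v.2), smul_zero]

/-- The underlying map of `Hom.ofSection M p v` is `q ↦ q • v`. [cite: Arapura2022, §1 (p. 3)] -/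
@[simp]
theorem Hom.ofSection_toLinearMap_apply (p : ℤ) (v : M.sections p) (q : ℚ) :
    (Hom.ofSection M p v).toLinearMap q = q • (v : V) :=
  rfl

/-- **`Hom(ℚ(−p), M) ≃ Γ_p(M)`, `φ ↦ φ(1)`** — the morphisms from the Tate object `ℚ(−p)` to a relative limit MHS are
its sections of type `(p, p)` (`Γ = Hom(𝟙, −)` twisted; inverse `v ↦ (q ↦ q • v)`).
[cite: DeligneMilne1982Tannakian, §1 (1.6.4)] [cite: Arapura2022, §1 (p. 3)] [cite: Kashiwara1986, §5.8 (p. 1021)] -/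
def tateHomEquivSections (p : ℤ) : Hom (tate (-p)) M ≃ M.sections p where
  toFun φ := ⟨φ.toLinearMap 1, Hom.apply_one_mem_sections M p φ⟩
  invFun v := Hom.ofSection M p v
  left_inv φ := Hom.ext (LinearMap.ext_ring (by rw [Hom.ofSection_toLinearMap_apply, one_smul]))
  right_inv v := Subtype.ext (by
    change (1 : ℚ) • (v : V) = v
    rw [one_smul])

/-- The section of `φ : ℚ(−p) → M` is `φ(1)`. [cite: Arapura2022, §1 (p. 3)] -/
@[simp]
theorem coe_tateHomEquivSections_apply (p : ℤ) (φ : Hom (tate (-p)) M) :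
    (M.tateHomEquivSections p φ : V) = φ.toLinearMap 1 :=
  rfl

/-- A morphism `ℚ(−p) → M` vanishes on vectors iff its section `φ(1)` is zero. [cite: Arapura2022, §1 (p. 3)] -/
theorem Hom.tate_toLinearMap_eq_zero_iff (p : ℤ) (φ : Hom (tate (-p)) M) :
    φ.toLinearMap = 0 ↔ φ.toLinearMap 1 = 0 :=
  ⟨fun h => by rw [h, LinearMap.zero_apply], fun h => LinearMap.ext_ring (by rw [h, LinearMap.zero_apply])⟩

end TateHom

/-! ## §3 `Hom(L₁, L₂) ≃ Γ_0(Hom(L₁, L₂))` and `Hom(L₁, L₂(p)) ≃ Γ_p(Hom(L₁, L₂))` -/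

section HomSections

variable {V : Type u} [AddCommGroup V] [Module ℚ V] [FiniteDimensional ℚ V]
variable {V' : Type u} [AddCommGroup V'] [Module ℚ V'] [FiniteDimensional ℚ V']
variable (L₁ : RelativeLimitMixedHodgeStructure V) (L₂ : RelativeLimitMixedHodgeStructure V')

/-- **A morphism `φ : L₁ → L₂` of relative limit MHS is a section of type `(0, 0)` of `Hom(L₁, L₂)`** (the tree's
`Hom.toLinearMap_mem_hom_wf_zero`, `Hom.toLinearMap_mem_hodgeClasses_hom`, `Hom.hom_N_toLinearMap`, repackaged).
[cite: DeligneMilne1982Tannakian, §1 (1.6.4)] [cite: DeligneHodgeII1971, 1.1.12 and 2.1.11.1] [cite: Kashiwara1986, §4.3 (p. 1007)] -/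
theorem Hom.toLinearMap_mem_hom_sections (φ : Hom L₁ L₂) : φ.toLinearMap ∈ (L₁.hom L₂).sections 0 :=
  ((L₁.hom L₂).mem_sections_iff 0 _).2 ⟨by simpa only [mul_zero] using φ.toLinearMap_mem_hom_wf_zero,
    φ.toLinearMap_mem_hodgeClasses_hom, φ.hom_N_toLinearMap⟩

/-- A section `f ∈ Γ_0(Hom(L₁, L₂))` in the form consumed by the tree's `homEquiv`. [cite: Kashiwara1986, §5.8 (p. 1021)] -/
theorem mem_hodgeClasses_and_of_mem_hom_sections (f : (L₁.hom L₂).sections 0) :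
    (f : V →ₗ[ℚ] V') ∈ (L₁.hom L₂).toMixedHodgeStructure.hodgeClasses 0 ∧ (f : V →ₗ[ℚ] V') ∈ (L₁.hom L₂).wf 0 ∧
      (L₁.hom L₂).N f = 0 :=
  ⟨(L₁.hom L₂).sections_le_hodgeClasses 0 f.2, by simpa only [mul_zero] using (L₁.hom L₂).sections_le_wf 0 f.2,
    LinearMap.mem_ker.1 ((L₁.hom L₂).sections_le_ker 0 f.2)⟩

/-- **`Hom(L₁, L₂) ≃ Γ_0(Hom(L₁, L₂))`, `φ ↦ φ`: THE MORPHISMS OF RELATIVE LIMIT MHS `L₁ → L₂` ARE THE SECTIONS OF TYPE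
`(0, 0)` OF THE INNER HOM** — the linear maps in `Hom(W^f₁, W^f₂)_0 ∩ Hdg⁰(Hom((W₁, F₁), (W₂, F₂)))` killed by
`f ↦ N₂f − fN₁` («`Hom(X, Y) = Hom(1, Hom(X, Y))`» for Kashiwara's inner Hom of IMHM's; the tree's `homEquiv` with its
target repackaged as the submodule `sections 0`). [cite: DeligneMilne1982Tannakian, §1 (1.6.4)] [cite: Kashiwara1986, §4.3 (p. 1007) and §5.8 (p. 1021)]
[cite: DeligneHodgeII1971, 1.1.12 and 2.1.11.1] [cite: CattaniElZeinGriffithsLe2014, Ch. 3 §3.1.1.3 Remark p. 132 and Remark 8.2.2] -/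
def homEquivSections : Hom L₁ L₂ ≃ (L₁.hom L₂).sections 0 where
  toFun φ := ⟨φ.toLinearMap, Hom.toLinearMap_mem_hom_sections L₁ L₂ φ⟩
  invFun f := (homEquiv L₁ L₂).symm ⟨f, mem_hodgeClasses_and_of_mem_hom_sections L₁ L₂ f⟩
  left_inv _ := Hom.ext rfl
  right_inv _ := Subtype.ext rfl

/-- The section of `φ` is its underlying map. [cite: DeligneMilne1982Tannakian, §1 (1.6.4)] -/
@[simp]
theorem coe_homEquivSections_apply (φ : Hom L₁ L₂) :
    (homEquivSections L₁ L₂ φ : V →ₗ[ℚ] V') = φ.toLinearMap :=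
  rfl

/-- The morphism of a section has that section as underlying map. [cite: DeligneMilne1982Tannakian, §1 (1.6.4)] -/
@[simp]
theorem homEquivSections_symm_apply_toLinearMap (f : (L₁.hom L₂).sections 0) :
    ((homEquivSections L₁ L₂).symm f).toLinearMap = f :=
  rfl

/-- A morphism `φ : L₁ → L₂(p)` lies in `W^f_{2p} Hom(L₁, L₂)` (`W^f_k L₂(p) = W^f_{k+2p} L₂`).
[cite: Kashiwara1986, §4.3 (p. 1007)] [cite: CattaniElZeinGriffithsLe2014, Remark 8.2.2 and Ex. 3.2.23 (4)] -/
theorem Hom.toLinearMap_mem_hom_wf_of_tateTwist (p : ℤ) (φ : Hom L₁ (L₂.tateTwist p)) :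
    φ.toLinearMap ∈ (L₁.hom L₂).wf (2 * p) := by
  rw [mem_hom_wf_iff]
  intro k x hx
  exact φ.apply_mem_wf hx

/-- **A morphism `φ : L₁ → L₂(p)` is a section of type `(p, p)` of `Hom(L₁, L₂)`.** [cite: DeligneHodgeII1971, 1.1.12 and 2.1.11.1]
[cite: Kashiwara1986, §4.3 (p. 1007)] -/
theorem Hom.toLinearMap_mem_hom_sections_of_tateTwist (p : ℤ) (φ : Hom L₁ (L₂.tateTwist p)) :
    φ.toLinearMap ∈ (L₁.hom L₂).sections p := by
  refine ((L₁.hom L₂).mem_sections_iff p _).2 ⟨Hom.toLinearMap_mem_hom_wf_of_tateTwist L₁ L₂ p φ,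
    MixedHodgeStructure.Hom.toLinearMap_mem_hodgeClasses_hom _ _ φ.toHom, ?_⟩
  rw [hom_N_apply, sub_eq_zero]
  exact φ.comm_N.symm

/-- **A section `f ∈ Γ_p(Hom(L₁, L₂))` is a morphism `L₁ → L₂(p)`.** [cite: DeligneHodgeII1971, 1.1.12 and 2.1.11.1]
[cite: CattaniElZeinGriffithsLe2014, Remark 8.2.2 and Ex. 3.2.23 (4)] -/
def Hom.ofHomSectionTwist (p : ℤ) (f : (L₁.hom L₂).sections p) : Hom L₁ (L₂.tateTwist p) where
  toHom := MixedHodgeStructure.Hom.ofIsHom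
    ((MixedHodgeStructure.mem_hodgeClasses_hom_iff L₁.toMixedHodgeStructure L₂.toMixedHodgeStructure p f.1).1
      ((L₁.hom L₂).sections_le_hodgeClasses p f.2))
  map_wf_le k := by
    rintro _ ⟨x, hx, rfl⟩
    exact (L₁.mem_hom_wf_iff L₂ (2 * p) f.1).1 ((L₁.hom L₂).sections_le_wf p f.2) k x hx
  comm_N := by
    have h := LinearMap.mem_ker.1 ((L₁.hom L₂).sections_le_ker p f.2)
    rw [hom_N_apply, sub_eq_zero] at h
    exact h.symm

/-- The underlying map of `Hom.ofHomSectionTwist p f` is `f`. [cite: DeligneHodgeII1971, 1.1.12] -/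
@[simp]
theorem Hom.ofHomSectionTwist_toLinearMap (p : ℤ) (f : (L₁.hom L₂).sections p) :
    (Hom.ofHomSectionTwist L₁ L₂ p f).toLinearMap = f :=
  rfl

/-- **`Hom(L₁, L₂(p)) ≃ Γ_p(Hom(L₁, L₂))`, `φ ↦ φ`** — morphisms of type `(p, p)` are the `(p, p)`-sections of the
inner Hom. [cite: DeligneHodgeII1971, 1.1.12 and 2.1.11.1] [cite: DeligneMilne1982Tannakian, §1 (1.6.4)]
[cite: Kashiwara1986, §4.3 (p. 1007)] -/
def homTateTwistEquivSections (p : ℤ) : Hom L₁ (L₂.tateTwist p) ≃ (L₁.hom L₂).sections p where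
  toFun φ := ⟨φ.toLinearMap, Hom.toLinearMap_mem_hom_sections_of_tateTwist L₁ L₂ p φ⟩
  invFun f := Hom.ofHomSectionTwist L₁ L₂ p f
  left_inv _ := Hom.ext rfl
  right_inv _ := Subtype.ext rfl

/-- The section of `φ : L₁ → L₂(p)` is its underlying map. [cite: DeligneHodgeII1971, 1.1.12] -/
@[simp]
theorem coe_homTateTwistEquivSections_apply (p : ℤ) (φ : Hom L₁ (L₂.tateTwist p)) :
    (homTateTwistEquivSections L₁ L₂ p φ : V →ₗ[ℚ] V') = φ.toLinearMap :=
  rfl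

/-! ## §4 El Zein's map on morphisms: `homGrMap [φ] = Gr_i φ` -/

/-- **The class `[φ] ∈ Gr^{W^f}_0 Hom(L₁, L₂)` of a morphism `φ : L₁ → L₂` is sent by El Zein's map to the graded map
`Gr^{W^f}_i φ : Gr_i L₁ → Gr_i L₂`** (`RelativeLimitMixedHodgeStructure.Hom.grMap`). [cite: Elzein1983, §II.0.2]
[cite: CattaniElZeinGriffithsLe2014, Remark 8.2.2] -/
theorem homGrMap_mk_toLinearMap (φ : Hom L₁ L₂) (i : ℤ) :
    L₁.homGrMap L₂ 0 i i (add_zero i) (Submodule.Quotient.mk ⟨φ.toLinearMap, φ.toLinearMap_mem_hom_wf_zero⟩) =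
      φ.grMap i :=
  Submodule.linearMap_qext _ (LinearMap.ext fun _ => rfl)

/-- The same for the section of `φ`: `homGrMap [homEquivSections φ] = Gr_i φ`. [cite: Elzein1983, §II.0.2] -/
theorem homGrMap_mk_homEquivSections (φ : Hom L₁ L₂) (i : ℤ) :
    L₁.homGrMap L₂ 0 i i (add_zero i)
        (Submodule.Quotient.mk ⟨(homEquivSections L₁ L₂ φ : V →ₗ[ℚ] V'),
          by simpa only [mul_zero] using (L₁.hom L₂).sections_le_wf 0 (homEquivSections L₁ L₂ φ).2⟩) =
      φ.grMap i :=
  Submodule.linearMap_qext _ (LinearMap.ext fun _ => rfl)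

end HomSections

end RelativeLimitMixedHodgeStructure

end Literature.AlgebraicGeometry.HodgeTheory
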